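import Literature.Probability.Percolation.DiscreteDomainPaths
import HarnessLib

/-!
# Deterministic transfer of discrete crossings between nearby domains (flower-domain sandwich)

Crux `Summit.CriticalPhenomena.CardyFormulaZ2.Theses.CardyUniqueLimit.CardyRigidity`
(stmt-CriticalPhenomena-0746), line `crossing_martingale`, stub `stub_slitCrossingData` (the
slit-crossing data of the bond-`ℤ²` exploration under the all-rectangle hypothesis), piece
**(P-soft), deterministic half**: Camia–Newman's event sandwich (PTRF 139 (2007), proof of
Thm 3, eq. (12), and Lemma 7.3, eqs. (17)/(20)).  If a domain `Ω₁` with boundary arcs `A₁`, `B₁`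
sits inside a domain `Ω₂` with boundary arcs `A`, `B` in "flower position" — `Ω₁` meets `∂Ω₂`
only well inside the arcs `A`, `B`, its own arcs `A₁`, `B₁` poke out of `Ω₂` near `A`, `B`
("petals"), the rest of `Ω₁` lies in the bulk of the largest mesh component of `Ω₂`, all with a
margin `m > δ` — then at mesh `δ` EVERY configuration with an open crossing of `(Ω₁)_δ` from the
discrete arc of `A₁` to that of `B₁` has an open crossing of `(Ω₂)_δ` from the discrete arc of
`A` to that of `B`:

    discreteCrossing Ω₁ δ A₁ B₁ ⊆ discreteCrossing Ω₂ δ A B.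

The same statement serves both halves of the sandwich: for the lower bound `(Ω₁; A₁, B₁)` is the
fixed inner flower domain and `(Ω₂; A, B)` the varying domain; for the upper bound `(Ω₁; A₁, B₁)`
is the varying domain and `(Ω₂; A, B)` the fixed outer flower domain (with its source/target arcs
enlarged by the connecting curves).  All hypotheses are metric (`Metric.infDist`) statements about
the two triples plus the bulk property of H21's largest-component discretisation `meshDomain`;
no planar topology is used here (it enters only when the flower domains are constructed).

* `Transfer.exists_reachable_of_walk` — the abstract combinatorial core: an invariant walked
  along a path of the source graph ("unanchored near `A`" / "anchored: joined inside the target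
  graph to the discrete arc of `A`") produces a target crossing, given a classification of the
  steps that are not target edges ("breaks happen near `A` or near `B`, and a break at a vertex
  of the target domain puts that vertex on the corresponding discrete arc");
* `Transfer.break_type`, `Transfer.mem_discreteArc_of_break` — the classification for H21's
  discretisation recipe (`meshDomain`, `discreteDomainGraph`, `discreteArc`);
* `slitCrossing_discreteCrossing_subset_of_margins` — the transfer theorem.
-/

noncomputable section

open Set Metric
open Literature.Probability.LatticeModels Literature.Probability.Percolation

namespace Summit.CriticalPhenomena.CardyFormulaZ2.Cruxes.CardyRigidity.CrossingMartingale

namespace Transfer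

/-! ### The abstract walk invariant -/

section Abstract

variable {V : Type*} {G₁ G : SimpleGraph V} {M X₀ X₂ : Set V} {T₀ T₂ : V → Prop}

/-- The endpoint of a walk of a graph whose edges have both endpoints in `M` lies in `M` if its
start does. [folklore] -/
theorem mem_of_walk (hGM : ∀ ⦃c c'⦄, G.Adj c c' → c ∈ M ∧ c' ∈ M) {u c : V} (q : G.Walk u c)
    (hu : u ∈ M) : c ∈ M := by
  induction q with
  | nil => exact hu
  | cons h _ ih => exact ih (hGM h).2

/-- **The abstract crossing transfer.**  Let `G₁` (source) and `G` (target) be graphs on `V`,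
`M ⊇ X₀` the vertex set of the target domain with its two discrete arcs `X₀`, `X₂`, and `T₀`,
`T₂` two mutually exclusive "closeness types".  Assume that every source step which is not a
target step joins two vertices of the same type, and puts each of its endpoints lying in `M` on
the discrete arc of its type.  Then a source walk started either outside `M` at a type-`0`
vertex or at a vertex joined in `G` to `X₀`, and ended outside `M` at a type-`2` vertex, forces
a `G`-connection from `X₀` to `X₂` (walk the invariant "type `0` outside `M`, or anchored to
`X₀`" along the path; it cannot survive to the end, and it dies only at a vertex of `X₂`).
[cite: CamiaNewman2007, Lemma 7.3] -/
theorem exists_reachable_of_walk (hGM : ∀ ⦃c c'⦄, G.Adj c c' → c ∈ M ∧ c' ∈ M) (hX₀ : X₀ ⊆ M)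
    (hTX : ∀ ⦃v⦄, T₀ v → T₂ v → False)
    (hBT : ∀ ⦃c c'⦄, G₁.Adj c c' → ¬ G.Adj c c' → (T₀ c ∧ T₀ c') ∨ (T₂ c ∧ T₂ c'))
    (hBX : ∀ ⦃c c'⦄, G₁.Adj c c' → ¬ G.Adj c c' → c ∈ M → (T₀ c → c ∈ X₀) ∧ (T₂ c → c ∈ X₂))
    {c y : V} (p : G₁.Walk c y) (hc : (T₀ c ∧ c ∉ M) ∨ ∃ u ∈ X₀, G.Reachable u c)
    (hyM : y ∉ M) (hyT : T₂ y) : ∃ u ∈ X₀, ∃ w ∈ X₂, G.Reachable u w := by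
  induction p with
  | nil =>
    rcases hc with ⟨hT, -⟩ | ⟨u, hu, ⟨q⟩⟩
    · exact (hTX hT hyT).elim
    · exact (hyM (mem_of_walk hGM q (hX₀ hu))).elim
  | @cons c c' y hadj p ih =>
    by_cases hG : G.Adj c c'
    · rcases hc with ⟨-, hcM⟩ | ⟨u, hu, hr⟩
      · exact (hcM (hGM hG).1).elim
      · exact ih (Or.inr ⟨u, hu, hr.trans hG.reachable⟩) hyM hyT
    · rcases hBT hadj hG with ⟨h0, h0'⟩ | ⟨h2, -⟩
      · by_cases hc'M : c' ∈ M
        · have hX : c' ∈ X₀ := (hBX hadj.symm (fun h ↦ hG h.symm) hc'M).1 h0'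
          exact ih (Or.inr ⟨c', hX, SimpleGraph.Reachable.refl _⟩) hyM hyT
        · exact ih (Or.inl ⟨h0', hc'M⟩) hyM hyT
      · rcases hc with ⟨hT, -⟩ | ⟨u, hu, hr⟩
        · exact (hTX hT h2).elim
        · obtain ⟨q⟩ := hr
          exact ⟨u, hu, c, (hBX hadj hG (mem_of_walk hGM q (hX₀ hu))).2 h2, ⟨q⟩⟩

end Abstract

/-! ### Mesh geometry of one step -/

variable {Ω₁ Ω₂ A B : Set ℂ} {δ m : ℝ}

/-- Every point of a closed mesh edge is within `|δ|` of its first endpoint. [folklore] -/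
theorem dist_le_of_mem_segment {x y : Site 2} (hxy : (zdGraph 2).Adj x y) {w : ℂ}
    (hw : w ∈ segment ℝ (meshPoint δ x) (meshPoint δ y)) : dist (meshPoint δ x) w ≤ |δ| := by
  have hsub : segment ℝ (meshPoint δ x) (meshPoint δ y) ⊆ closedBall (meshPoint δ x) |δ| :=
    (convex_closedBall _ _).segment_subset (mem_closedBall_self (abs_nonneg δ))
      (by rw [mem_closedBall, dist_comm, dist_meshPoint_of_adj hxy])
  have := hsub hw
  rwa [mem_closedBall, dist_comm] at this

/-- A step of the open source graph: an open lattice edge whose closed segment lies in `Ω̄₁` and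
whose endpoints are mesh vertices of `Ω₁`. [folklore] -/
theorem step_facts {ω : BondConfig (Site 2)} {c c' : Site 2}
    (h : (openGraph ω ⊓ discreteDomainGraph Ω₁ δ).Adj c c') :
    s(c, c') ∈ ω ∧ (zdGraph 2).Adj c c' ∧
      segment ℝ (meshPoint δ c) (meshPoint δ c') ⊆ closure Ω₁ ∧
      meshPoint δ c ∈ Ω₁ ∧ meshPoint δ c' ∈ Ω₁ := by
  obtain ⟨hω, hmesh, hc, hc'⟩ := open_inf_discreteDomainGraph_adj_iff.1 h
  obtain ⟨hzd, hseg⟩ := meshGraph_adj_iff.1 hmesh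
  exact ⟨hω, hzd, hseg, meshDomain_subset_meshVertices _ _ hc, meshDomain_subset_meshVertices _ _ hc'⟩

/-- **A step leaving `Ω₂` carries a frontier point within `|δ|` of both endpoints.**
[folklore] -/
theorem exists_frontier_of_not_subset (hΩ₂ : IsOpen Ω₂) {c c' : Site 2}
    (hadj : (zdGraph 2).Adj c c') (hc : meshPoint δ c ∈ Ω₂)
    (hseg : ¬ segment ℝ (meshPoint δ c) (meshPoint δ c') ⊆ Ω₂) :
    ∃ f ∈ frontier Ω₂, f ∈ segment ℝ (meshPoint δ c) (meshPoint δ c') ∧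
      dist (meshPoint δ c) f ≤ |δ| ∧ dist (meshPoint δ c') f ≤ |δ| := by
  obtain ⟨f, hf, hff⟩ := exists_mem_segment_frontier hΩ₂ hc hseg
  refine ⟨f, hff, hf, dist_le_of_mem_segment hadj hf, ?_⟩
  rw [segment_symm] at hf
  exact dist_le_of_mem_segment hadj.symm hf

/-! ### The break classification for H21's discretisation recipe -/

/-- **Types near a frontier contact.** If a frontier point `f` of `Ω₂` on the closure of `Ω₁`
lies on `A` or on `B` (hypothesis (H4)), then two points within `|δ| < m` of `f` are both
`A`-close or both `B`-close. [cite: CamiaNewman2007, Lemma 7.3] -/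
theorem types_of_frontier (hδm : |δ| < m)
    (H4 : ∀ f ∈ closure Ω₁ ∩ frontier Ω₂,
      (f ∈ A ∧ 2 * |δ| ≤ infDist f (frontier Ω₂ \ A)) ∨ (f ∈ B ∧ 2 * |δ| ≤ infDist f (frontier Ω₂ \ B)))
    {f p q : ℂ} (hf₁ : f ∈ closure Ω₁) (hf₂ : f ∈ frontier Ω₂) (hp : dist p f ≤ |δ|)
    (hq : dist q f ≤ |δ|) :
    (infDist p A < m ∧ infDist q A < m) ∨ (infDist p B < m ∧ infDist q B < m) := by
  rcases H4 f ⟨hf₁, hf₂⟩ with ⟨hfA, -⟩ | ⟨hfB, -⟩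
  · left
    exact ⟨(infDist_le_dist_of_mem hfA).trans_lt (hp.trans_lt hδm),
      (infDist_le_dist_of_mem hfA).trans_lt (hq.trans_lt hδm)⟩
  · right
    exact ⟨(infDist_le_dist_of_mem hfB).trans_lt (hp.trans_lt hδm),
      (infDist_le_dist_of_mem hfB).trans_lt (hq.trans_lt hδm)⟩

/-- **Adjacent points have the same type** under the separation hypothesis (H3): an `A`-close
point is at distance `≥ m + |δ|` from `B`, so a point within `|δ|` of it is not `B`-close.
[folklore] -/
theorem same_type_of_dist_le (H3 : ∀ z, infDist z A < m → m + |δ| ≤ infDist z B) {p q : ℂ}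
    (hpq : dist p q ≤ |δ|) (hp : infDist p A < m ∨ infDist p B < m)
    (hq : infDist q A < m ∨ infDist q B < m) :
    (infDist p A < m ∧ infDist q A < m) ∨ (infDist p B < m ∧ infDist q B < m) := by
  rcases hp with hp | hp <;> rcases hq with hq | hq
  · exact Or.inl ⟨hp, hq⟩
  · exfalso
    have h1 := H3 p hp
    have h2 : infDist p B ≤ infDist q B + dist p q := infDist_le_infDist_add_dist
    linarith
  · exfalso
    have h1 := H3 q hq
    have h2 : infDist q B ≤ infDist p B + dist q p := infDist_le_infDist_add_dist
    rw [dist_comm] at h2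
    linarith
  · exact Or.inr ⟨hp, hq⟩

/-- **Break classification.**  A step of the open source graph of `Ω₁` that is not a step of
the open target graph of `Ω₂` joins two `A`-close vertices or two `B`-close vertices: either
its segment leaves `Ω₂` (then it carries a frontier point of `Ω₂` on `Ω̄₁`, which lies on `A` or
`B` by (H4), or both endpoints are outside `Ω₂` and (H5) applies), or it stays in `Ω₂` but
outside the largest mesh component (both endpoints at once, `mem_meshDomain_of_meshGraph_adj`),
where (H6) applies; (H3) synchronises the two endpoints. [cite: CamiaNewman2007, Lemma 7.3] -/
theorem break_type (hΩ₂ : IsOpen Ω₂) (hδm : |δ| < m)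
    (H3 : ∀ z, infDist z A < m → m + |δ| ≤ infDist z B)
    (H4 : ∀ f ∈ closure Ω₁ ∩ frontier Ω₂,
      (f ∈ A ∧ 2 * |δ| ≤ infDist f (frontier Ω₂ \ A)) ∨ (f ∈ B ∧ 2 * |δ| ≤ infDist f (frontier Ω₂ \ B)))
    (H5 : ∀ z ∈ Ω₁, z ∉ Ω₂ → infDist z A < m ∨ infDist z B < m)
    (H6 : ∀ v : Site 2, meshPoint δ v ∈ Ω₁ → meshPoint δ v ∈ Ω₂ → v ∉ meshDomain Ω₂ δ →
      infDist (meshPoint δ v) A < m ∨ infDist (meshPoint δ v) B < m)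
    {ω : BondConfig (Site 2)} {c c' : Site 2}
    (h₁ : (openGraph ω ⊓ discreteDomainGraph Ω₁ δ).Adj c c')
    (h₂ : ¬ (openGraph ω ⊓ discreteDomainGraph Ω₂ δ).Adj c c') :
    (infDist (meshPoint δ c) A < m ∧ infDist (meshPoint δ c') A < m) ∨
      (infDist (meshPoint δ c) B < m ∧ infDist (meshPoint δ c') B < m) := by
  obtain ⟨hω, hzd, hseg₁, hc₁, hc'₁⟩ := step_facts h₁
  have hcc' : dist (meshPoint δ c) (meshPoint δ c') ≤ |δ| := (dist_meshPoint_of_adj hzd).le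
  by_cases hseg : segment ℝ (meshPoint δ c) (meshPoint δ c') ⊆ Ω₂
  · -- the step stays in `Ω₂`: both endpoints are mesh vertices outside the largest component
    have hc₂ : meshPoint δ c ∈ Ω₂ := hseg (left_mem_segment ℝ _ _)
    have hc'₂ : meshPoint δ c' ∈ Ω₂ := hseg (right_mem_segment ℝ _ _)
    have hmesh : (meshGraph Ω₂ δ).Adj c c' := meshGraph_adj_iff.2 ⟨hzd, hseg.trans subset_closure⟩
    have hnot : ¬ (c ∈ meshDomain Ω₂ δ ∧ c' ∈ meshDomain Ω₂ δ) := fun hM ↦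
      h₂ (open_inf_discreteDomainGraph_adj_iff.2 ⟨hω, hmesh, hM.1, hM.2⟩)
    have hcM : c ∉ meshDomain Ω₂ δ := fun hcM ↦
      hnot ⟨hcM, mem_meshDomain_of_meshGraph_adj hcM hc'₂ hmesh⟩
    have hc'M : c' ∉ meshDomain Ω₂ δ := fun hc'M ↦
      hnot ⟨mem_meshDomain_of_meshGraph_adj hc'M hc₂ hmesh.symm, hc'M⟩
    exact same_type_of_dist_le H3 hcc' (H6 c hc₁ hc₂ hcM) (H6 c' hc'₁ hc'₂ hc'M)
  · by_cases hc₂ : meshPoint δ c ∈ Ω₂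
    · obtain ⟨f, hff, hfs, hcf, hc'f⟩ := exists_frontier_of_not_subset hΩ₂ hzd hc₂ hseg
      exact types_of_frontier hδm H4 (hseg₁ hfs) hff hcf hc'f
    · by_cases hc'₂ : meshPoint δ c' ∈ Ω₂
      · have hseg' : ¬ segment ℝ (meshPoint δ c') (meshPoint δ c) ⊆ Ω₂ := by
          rwa [segment_symm]
        obtain ⟨f, hff, hfs, hc'f, hcf⟩ := exists_frontier_of_not_subset hΩ₂ hzd.symm hc'₂ hseg'
        rw [segment_symm] at hfs
        exact types_of_frontier hδm H4 (hseg₁ hfs) hff hcf hc'f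
      · exact same_type_of_dist_le H3 hcc' (H5 _ hc₁ hc₂) (H5 _ hc'₁ hc'₂)

/-- **A break at a vertex of the target domain puts it on the discrete arc of its type.**  If
the source step `c → c'` is not a target step although `c ∈ meshDomain Ω₂ δ`, then its segment
leaves `Ω₂` (otherwise `c'` would follow `c` into the largest component), so it carries a
frontier point `f ∈ Ω̄₁ ∩ ∂Ω₂` within `|δ|` of `δc`; by (H4) `f` lies on `A` or `B`, `2|δ|`
away from the rest of `∂Ω₂`, and the type of `c` decides which (H3); hence `δc` is within `|δ|`
of that arc and at least `|δ|` from the rest of the frontier, i.e. `c` is on its discrete arc.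
[cite: CamiaNewman2007, Lemma 7.3] -/
theorem mem_discreteArc_of_break (hΩ₂ : IsOpen Ω₂) (hδm : |δ| < m)
    (H3 : ∀ z, infDist z A < m → m + |δ| ≤ infDist z B)
    (H4 : ∀ f ∈ closure Ω₁ ∩ frontier Ω₂,
      (f ∈ A ∧ 2 * |δ| ≤ infDist f (frontier Ω₂ \ A)) ∨ (f ∈ B ∧ 2 * |δ| ≤ infDist f (frontier Ω₂ \ B)))
    {ω : BondConfig (Site 2)} {c c' : Site 2}
    (h₁ : (openGraph ω ⊓ discreteDomainGraph Ω₁ δ).Adj c c')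
    (h₂ : ¬ (openGraph ω ⊓ discreteDomainGraph Ω₂ δ).Adj c c') (hcM : c ∈ meshDomain Ω₂ δ) :
    (infDist (meshPoint δ c) A < m → c ∈ discreteArc Ω₂ δ A) ∧
      (infDist (meshPoint δ c) B < m → c ∈ discreteArc Ω₂ δ B) := by
  obtain ⟨hω, hzd, hseg₁, -, -⟩ := step_facts h₁
  have hc₂ : meshPoint δ c ∈ Ω₂ := meshDomain_subset_meshVertices _ _ hcM
  -- the segment leaves `Ω₂`
  have hseg : ¬ segment ℝ (meshPoint δ c) (meshPoint δ c') ⊆ Ω₂ := by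
    intro hseg
    have hmesh : (meshGraph Ω₂ δ).Adj c c' := meshGraph_adj_iff.2 ⟨hzd, hseg.trans subset_closure⟩
    exact h₂ (open_inf_discreteDomainGraph_adj_iff.2 ⟨hω, hmesh, hcM,
      mem_meshDomain_of_meshGraph_adj hcM (hseg (right_mem_segment ℝ _ _)) hmesh⟩)
  -- `c` is a discrete boundary vertex of `Ω₂`
  have hcb : c ∈ meshBoundary Ω₂ δ := by
    refine ⟨hcM, c', hzd, fun hadj ↦ h₂ ?_⟩
    rw [SimpleGraph.inf_adj, openGraph_adj]
    exact ⟨⟨hω, hzd.ne⟩, hadj⟩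
  obtain ⟨f, hff, hfs, hcf, -⟩ := exists_frontier_of_not_subset hΩ₂ hzd hc₂ hseg
  have hf₁ : f ∈ closure Ω₁ := hseg₁ hfs
  -- the arc of `f` gives the discrete arc of `c`
  have key : ∀ {A' : Set ℂ}, f ∈ A' → 2 * |δ| ≤ infDist f (frontier Ω₂ \ A') →
      c ∈ discreteArc Ω₂ δ A' := by
    intro A' hfA hdeep
    refine ⟨hcb, ?_⟩
    have h1 : infDist (meshPoint δ c) A' ≤ |δ| := (infDist_le_dist_of_mem hfA).trans hcf
    have h2 : infDist f (frontier Ω₂ \ A') ≤ infDist (meshPoint δ c) (frontier Ω₂ \ A') +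
        dist f (meshPoint δ c) := infDist_le_infDist_add_dist
    rw [dist_comm] at h2
    linarith
  constructor
  · intro hcA
    rcases H4 f ⟨hf₁, hff⟩ with ⟨hfA, hdeep⟩ | ⟨hfB, -⟩
    · exact key hfA hdeep
    · exfalso
      have h1 : infDist (meshPoint δ c) B ≤ |δ| := (infDist_le_dist_of_mem hfB).trans hcf
      have h2 := H3 _ hcA
      linarith [abs_nonneg δ]
  · intro hcB
    rcases H4 f ⟨hf₁, hff⟩ with ⟨hfA, -⟩ | ⟨hfB, hdeep⟩
    · exfalso
      have h1 : infDist (meshPoint δ c) A ≤ |δ| := (infDist_le_dist_of_mem hfA).trans hcf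
      have h2 := H3 _ (h1.trans_lt hδm)
      have h3 : infDist (meshPoint δ c) B < m := hcB
      linarith [abs_nonneg δ]
    · exact key hfB hdeep

end Transfer

open Transfer in
/-- **Transfer of discrete crossings between domains in flower position** (the deterministic
half of Camia–Newman's sandwich (12)/(17)/(20), for H21's discretisation `discreteCrossing` of
bond percolation on `δℤ²`).  Let `Ω₁, Ω₂` be open, `A₁, B₁` ("source/target arcs of `Ω₁`") and
`A, B` (boundary arcs of `Ω₂`) sets, `0 < δ < m`.  Assume: (H1)/(H2) points of `Ω₁` within `δ`
of `A₁` (resp. `B₁`) are `A`-close (resp. `B`-close: `infDist < m`) and outside `Ω₂` (the petals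
poke out); (H3) `A`-close points are `≥ m + δ` from `B`; (H4) `Ω̄₁` meets `∂Ω₂` only at points
of `A` or `B` at distance `≥ 2δ` from the rest of `∂Ω₂`; (H5) points of `Ω₁ ∖ Ω₂` are `A`- or
`B`-close; (H6) mesh vertices of `Ω₂` lying in `Ω₁` but outside the largest mesh component
`meshDomain Ω₂ δ` are `A`- or `B`-close (bulk property of `Ω₂` plus depth of `Ω₁` away from the
arcs).  Then every open crossing of `(Ω₁)_δ` between the discrete arcs of `A₁` and `B₁` contains
an open crossing of `(Ω₂)_δ` between the discrete arcs of `A` and `B`.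
[cite: CamiaNewman2007, Thm 3 and Lemma 7.3] -/
theorem slitCrossing_discreteCrossing_subset_of_margins : ∀ (Ω₁ Ω₂ A₁ B₁ A B : Set ℂ) (δ m : ℝ), IsOpen Ω₁ → IsOpen Ω₂ → 0 < δ → δ < m → (∀ z ∈ Ω₁, Metric.infDist z A₁ ≤ δ → Metric.infDist z A < m ∧ z ∉ Ω₂) → (∀ z ∈ Ω₁, Metric.infDist z B₁ ≤ δ → Metric.infDist z B < m ∧ z ∉ Ω₂) → (∀ z, Metric.infDist z A < m → m + δ ≤ Metric.infDist z B) → (∀ f ∈ closure Ω₁ ∩ frontier Ω₂, (f ∈ A ∧ 2 * δ ≤ Metric.infDist f (frontier Ω₂ \ A)) ∨ (f ∈ B ∧ 2 * δ ≤ Metric.infDist f (frontier Ω₂ \ B))) → (∀ z ∈ Ω₁, z ∉ Ω₂ → Metric.infDist z A < m ∨ Metric.infDist z B < m) → (∀ v : Literature.Probability.LatticeModels.Site 2, Literature.Probability.LatticeModels.meshPoint δ v ∈ Ω₁ → Literature.Probability.LatticeModels.meshPoint δ v ∈ Ω₂ → v ∉ Literature.Probability.LatticeModels.meshDomain Ω₂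 δ → Metric.infDist (Literature.Probability.LatticeModels.meshPoint δ v) A < m ∨ Metric.infDist (Literature.Probability.LatticeModels.meshPoint δ v) B < m) → Literature.Probability.Percolation.discreteCrossing Ω₁ δ A₁ B₁ ⊆ Literature.Probability.Percolation.discreteCrossing Ω₂ δ A B := by
  intro Ω₁ Ω₂ A₁ B₁ A B δ m hΩ₁ hΩ₂ hδ hδm H1 H2 H3 H4 H5 H6 ω hω
  have habs : |δ| = δ := abs_of_pos hδ
  rw [← habs] at hδm H1 H2 H3 H4
  obtain ⟨x, hx, y, hy, hr⟩ := hω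
  obtain ⟨p⟩ := hr
  -- the endpoints: `x` is `A`-close outside `Ω₂`, `y` is `B`-close outside `Ω₂`
  have hxΩ₁ : meshPoint δ x ∈ Ω₁ :=
    meshDomain_subset_meshVertices _ _ (meshBoundary_subset_meshDomain _ _ hx.1)
  have hyΩ₁ : meshPoint δ y ∈ Ω₁ :=
    meshDomain_subset_meshVertices _ _ (meshBoundary_subset_meshDomain _ _ hy.1)
  obtain ⟨hxA, hxΩ₂⟩ := H1 _ hxΩ₁ (infDist_le_of_mem_discreteArc hΩ₁ hx)
  obtain ⟨hyB, hyΩ₂⟩ := H2 _ hyΩ₁ (infDist_le_of_mem_discreteArc hΩ₁ hy)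
  have hxM : x ∉ meshDomain Ω₂ δ := fun h ↦ hxΩ₂ (meshDomain_subset_meshVertices _ _ h)
  have hyM : y ∉ meshDomain Ω₂ δ := fun h ↦ hyΩ₂ (meshDomain_subset_meshVertices _ _ h)
  -- the abstract transfer
  obtain ⟨u, hu, w, hw, huw⟩ := exists_reachable_of_walk
    (G₁ := openGraph ω ⊓ discreteDomainGraph Ω₁ δ) (G := openGraph ω ⊓ discreteDomainGraph Ω₂ δ)
    (M := meshDomain Ω₂ δ) (X₀ := discreteArc Ω₂ δ A) (X₂ := discreteArc Ω₂ δ B)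
    (T₀ := fun v ↦ infDist (meshPoint δ v) A < m) (T₂ := fun v ↦ infDist (meshPoint δ v) B < m)
    (fun c c' h ↦ ⟨(open_inf_discreteDomainGraph_adj_iff.1 h).2.2.1,
      (open_inf_discreteDomainGraph_adj_iff.1 h).2.2.2⟩)
    ((discreteArc_subset_meshBoundary _ _ _).trans (meshBoundary_subset_meshDomain _ _))
    (fun v h0 h2 ↦ by
      have := H3 _ h0
      have h2' : infDist (meshPoint δ v) B < m := h2
      linarith [abs_nonneg δ])
    (fun c c' h₁ h₂ ↦ break_type hΩ₂ hδm H3 H4 H5 H6 h₁ h₂)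
    (fun c c' h₁ h₂ hcM ↦ mem_discreteArc_of_break hΩ₂ hδm H3 H4 h₁ h₂ hcM)
    p (Or.inl ⟨hxA, hxM⟩) hyM hyB
  exact ⟨u, hu, w, hw, huw⟩

/-- **(H6) from the bulk property and the depth of `Ω₁`.**  If every mesh vertex of `Ω₂` at
distance `≥ m₂` from `∂Ω₂` lies in the largest mesh component (the bulk property at depth `m₂`,
cf. `Literature.Probability.Percolation.forall_mem_meshDomain_of_isCompact`) and the points of
`Ω₁ ∩ Ω₂` within `m₂` of `∂Ω₂` are `A`- or `B`-close, then hypothesis (H6) of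
`slitCrossing_discreteCrossing_subset_of_margins` holds. [folklore] -/
theorem Transfer.h6_of_bulk {Ω₁ Ω₂ A B : Set ℂ} {δ m m₂ : ℝ}
    (hbulk : ∀ v : Site 2, meshPoint δ v ∈ Ω₂ → m₂ ≤ infDist (meshPoint δ v) (frontier Ω₂) →
      v ∈ meshDomain Ω₂ δ)
    (hshallow : ∀ z ∈ Ω₁ ∩ Ω₂, infDist z (frontier Ω₂) < m₂ → infDist z A < m ∨ infDist z B < m) :
    ∀ v : Site 2, meshPoint δ v ∈ Ω₁ → meshPoint δ v ∈ Ω₂ → v ∉ meshDomain Ω₂ δ →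
      infDist (meshPoint δ v) A < m ∨ infDist (meshPoint δ v) B < m := by
  intro v hv₁ hv₂ hvM
  refine hshallow _ ⟨hv₁, hv₂⟩ (lt_of_not_ge fun h ↦ hvM (hbulk v hv₂ h))

end Summit.CriticalPhenomena.CardyFormulaZ2.Cruxes.CardyRigidity.CrossingMartingale

end
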